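import Literature.IUT.HodgeTheaters.InitialThetaDataTransporterEquiv
import Literature.AnabelianGeometry.AbsoluteAnabelian.AbsAnabUnitsTransportHolds
import Literature.AnabelianGeometry.AbsoluteAnabelian.AbsAnabUnitsTransportUnique
import Literature.NumberTheory.LocalFields.EquivariantUnitRigidityNormed
import HarnessLib

/-!
# [IUTchI] Cor 5.3 (ii) at a GOOD nonarchimedean place — the surjectivity half via [AbsTopIII] Prop 3.2 (iv):
# for EVERY transporter `n` of `Π_v̲` the `φ_n`-EQUIVARIANT multiplicative `σ_n : K̄_v̲^× ⥲ K̄_v̲^×` EXISTS and is UNIQUE (FILE 2)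

S. Mochizuki, *Inter-universal Teichmüller theory I*, kurims manuscript (May 2020), §5 Corollary 5.3 (ii) p. 144 l. 13–15 («the natural
map `Isom(¹𝔉, ²𝔉) → Isom(¹𝔇, ²𝔇)` [cf. Remark 5.2.1, (i)] is bijective») with its printed proof p. 144 l. 33–34 («follows immediately
from [AbsTopIII], Proposition 3.2, (iv); [AbsTopIII], Proposition 4.2, (i)»; doc v2: both quotes re-read on my own render, referee N24-F2 (a)(b)) ([IUTchI] Cor 5.3 (ii) p.144) [claim: Mochizuki2012, status: disputed] (D-0012 claim key, series status
DISPUTED — this file is PLUMBING between OUR kernel theorems; nothing of the series is asserted; no side is taken on [IUTchIII] Cor. 3.12).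
S. Mochizuki, *The Absolute Anabelian Geometry of Hyperbolic Curves* (2004), Prop. 1.2.1 (iii)/(iv)/(vi) pp. 10–11 — the items [AbsTopIII]'s
proof of Prop. 3.2 (iv) cites on its p. 73 (items (iii), (iv), per auditor aud-20's reading; doc v2, NOTE-1): (iii)/(iv) the preserved
images and Frobenius elements, (vi) the induced Galois-equivariant isomorphism of multiplicative groups (the tree's `Prop121vii.UnitsTransport`
packages exactly these three clauses; our gloss (`α`-equivariant identification `K̄₁^× ⥲ K̄₂^×`) names that package and is not a phrase of print) [cite: MochizukiAbsAnab2004, Prop 1.2.1 (vi) p.10];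
*Topics in Absolute Anabelian Geometry III*, Prop. 3.2 (iv) p. 72 [cite: MochizukiAbsTopIII2015, Proposition 3.2 (iv) p.72].

## What this file proves (cell abc-iut, L5 HUB node `IUTchI:Cor5.3(ii)`, SUPPORT row «LIFTSALL-SIGMA@GOOD» of abc-iut-w4-d047 for the
## LiftsAll target `goodLiftsAllAt_iff` (abc-iut-L5-t16, p501097) — the half booked as residual «needs the F_v-semilinear action, not in tree»)

abc-iut-L5-t16's `GenuineFKitMergeInputsLiftsAll`/`…LiftsGammaInner` (p501097/p503506/p504062) prove the surjectivity half `LiftsAll` of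
the Cor 5.3 (ii) model case at the genuine good slot for the Γ-INNER transporters (`augGF n ∈ im Gal(K̄_v̲/K_v̲)`) by a [FrdII]-level
transport along `pull φ_n ⋙ push aug ≅ push aug`, and book as residual the other transporters, asking for «the F_v-semilinear action on
K̄_v̲ (infrastructure, not in tree)» (that file's words).  THIS FILE supplies, for EVERY transporter, what a transport of the datum of
`GoodLocalFrobenioid.ofGalois` over `pull φ_n` reads on the monoids: a multiplicative `σ_n : k̄ˣ ⥲ k̄ˣ` with `σ_n (g • x) = φ_n g • σ_n x`,
carrying `𝒪^×_{k̄}` onto itself and uniformisers of `k` to uniformisers — by print's own citation, [AbsTopIII] Prop 3.2 (iv) = [AbsAnab]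
Prop 1.2.1 (vi), which abc-iut layer L4 holds as KERNEL THEOREMS (`Prop121vii.unitsTransport_holds`, abc-iut-L4-d3; uniqueness
`unitsTransport_unique`, abc-iut-L6-t13).  It is NOT additive / `k`-linear (for non-Γ-inner `n` it cannot be) — and the datum reads only
the multiplicative monoids `(k̄^U)^× ⊇ 𝒪^⊳` with Galois action and `ord`.
* §2 (L4's MLF currency `[IsNonarchimedeanLocalField k] [CharZero k]`): for EVERY `α : Gal(k̄/k) ≃ₜ* Gal(k̄/k)` (`k̄ = AlgebraicClosure k`),
  **`MLFSigma.sigma α : k̄ˣ ≃* k̄ˣ`** — `α`-equivariant, `PreservesAbsUnits`, `PreservesUniformizers`, UNIQUE (`sigma_unique`, `existsUnique_sigma`),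
  hence functorial (`sigma_refl`, `sigma_trans`, `sigma_symm`); fixed-point transport `forall_smul_sigma_eq_iff` (`(k̄ˣ)^U ↦ (k̄ˣ)^{α(U)}`).
* §3 AT abc-iut-L5-t2's PLACE DATA `(D, p, k, ι, hX)` (`k` complete ultrametric finite over `ℚ_p` is an MLF for the valuative relation of its
  norm: abc-iut-w4-d014 `isNonarchimedeanLocalField_of_finiteDimensional_padic`): `sigmaTransporter n := sigma (galTransporterCEquiv n)` (FILE 1),
  **`sigmaTransporter_smul : σ_n (augLoc z • x) = augLoc (φ_n z) • σ_n x`** — `(φ_n, σ_n)` is an automorphism of the pair `(Π_v̲ ↷ k̄ˣ)` —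
  `sigmaTransporter_smul_gal`, units/uniformisers, `sigmaTransporter_unique`, `sigmaTransporter_mul/_one/_inv` (`n ↦ σ_n` is a homomorphism),
  `forall_smul_sigmaTransporter_eq_iff`.
* §4 AT THE MERGE TERM (racer C's `KvAt/primeAt/localEmb`, racer B's seam `localDataOfBadPairs_H_at`, BY NAME): `exists_sigma_transporterAt` —
  for every `n ∈ N_{Π_{C_F}}((D.localDataOfBadPairs … x).H)` at a good nonarchimedean index.
Binders: t2's place data, racer B's `hinj`/seam; FACT unnamed 0 (the L4 theorems carry no fact binder); 0 `instance` (local `letI`/`haveI`)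
· 0 notation · no new `Prop` fact; defs `MLFSigma.sigma`, `GoodPlaceSigma.normValRel` (abbrev), `sigmaTransporter`.  HONEST FRAMING: OUR
transport data for OUR datum from OUR kernel theorems; typed ≠ inhabited ≠ proved; nothing here asserts abc proved or refuted.
-/

noncomputable section

namespace Literature.IUT.HodgeTheaters

open Literature.AnabelianGeometry.AbsoluteAnabelian Literature.AnabelianGeometry.SemiGraphs

/-! ### §2. The anabelian input in MLF currency: `σ_α : k̄ˣ ⥲ k̄ˣ`, `α`-equivariant, for EVERY `α : Gal(k̄/k) ≃ₜ* Gal(k̄/k)` -/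

namespace MLFSigma

variable (k : Type) [Field k] [ValuativeRel k] [TopologicalSpace k] [IsNonarchimedeanLocalField k] [CharZero k]

/-- **EXISTENCE of an `α`-equivariant, unit- and uniformiser-preserving `σ : k̄ˣ ⥲ k̄ˣ`** for every isomorphism of topological groups
`α : Gal(k̄/k) ⥲ Gal(k̄/k)` of an MLF `k` — ONE CALL of abc-iut-L4-d3's `Prop121vii.unitsTransport_holds` ([AbsAnab] Prop 1.2.1 (vi): the
identification induced by `α` on the abelianisations of the open subgroups) at `(k, k, α)`. [cite: MochizukiAbsAnab2004, Prop 1.2.1 (vi) p.10] -/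
theorem exists_sigma (α : Field.absoluteGaloisGroup k ≃ₜ* Field.absoluteGaloisGroup k) :
    ∃ ψ : (AlgebraicClosure k)ˣ ≃* (AlgebraicClosure k)ˣ,
      Prop121vii.IsAlphaEquivariant α ψ ∧ Prop121vii.PreservesAbsUnits ψ ∧ Prop121vii.PreservesUniformizers ψ :=
  Prop121vii.unitsTransport_holds k k α

/-- **`σ_α`**: THE `α`-equivariant uniformiser-preserving multiplicative automorphism of `k̄ˣ` (chosen from `exists_sigma`; unique by
`sigma_unique`). [cite: MochizukiAbsAnab2004, Prop 1.2.1 (vi) p.10] -/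
def sigma (α : Field.absoluteGaloisGroup k ≃ₜ* Field.absoluteGaloisGroup k) : (AlgebraicClosure k)ˣ ≃* (AlgebraicClosure k)ˣ :=
  (exists_sigma k α).choose

/-- `σ_α` is `α`-equivariant: `σ_α (γ • x) = α γ • σ_α x`. [cite: MochizukiAbsAnab2004, Prop 1.2.1 (vi) p.10] -/
theorem sigma_smul (α : Field.absoluteGaloisGroup k ≃ₜ* Field.absoluteGaloisGroup k) (γ : Field.absoluteGaloisGroup k)
    (x : (AlgebraicClosure k)ˣ) : sigma k α (γ • x) = α γ • sigma k α x :=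
  (exists_sigma k α).choose_spec.1 γ x

/-- `σ_α` is `α`-equivariant (predicate form). [cite: MochizukiAbsAnab2004, Prop 1.2.1 (vi) p.10] -/
theorem isAlphaEquivariant_sigma (α : Field.absoluteGaloisGroup k ≃ₜ* Field.absoluteGaloisGroup k) :
    Prop121vii.IsAlphaEquivariant α (sigma k α) :=
  (exists_sigma k α).choose_spec.1

/-- `σ_α` maps the units `𝒪_{k̄}^×` onto themselves ([AbsAnab] Prop 1.2.1 (iii): the unit groups are preserved).
[cite: MochizukiAbsAnab2004, Prop 1.2.1 (iii) p.10] -/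
theorem preservesAbsUnits_sigma (α : Field.absoluteGaloisGroup k ≃ₜ* Field.absoluteGaloisGroup k) :
    Prop121vii.PreservesAbsUnits (sigma k α) :=
  (exists_sigma k α).choose_spec.2.1

/-- `σ_α` carries uniformisers of `k` to uniformisers of `k` ([AbsAnab] Prop 1.2.1 (iv): the Frobenius element, hence the orientation of the value group, is preserved).
[cite: MochizukiAbsAnab2004, Prop 1.2.1 (iv) p.10] -/
theorem preservesUniformizers_sigma (α : Field.absoluteGaloisGroup k ≃ₜ* Field.absoluteGaloisGroup k) :
    Prop121vii.PreservesUniformizers (sigma k α) :=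
  (exists_sigma k α).choose_spec.2.2

/-- **UNIQUENESS**: any `α`-equivariant uniformiser-preserving `ψ` IS `σ_α` (abc-iut-L6-t13 `unitsTransport_unique`: two
`α`-equivariant ones are equal or mutually inverse, and the inverse alternative inverts uniformisers).
[cite: MochizukiAbsAnab2004, Prop 1.2.1 (vii) p.11] -/
theorem sigma_unique (α : Field.absoluteGaloisGroup k ≃ₜ* Field.absoluteGaloisGroup k)
    (ψ : (AlgebraicClosure k)ˣ ≃* (AlgebraicClosure k)ˣ) (hψ : Prop121vii.IsAlphaEquivariant α ψ)
    (hU : Prop121vii.PreservesUniformizers ψ) : ψ = sigma k α :=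
  Prop121vii.unitsTransport_unique (isAlphaEquivariant_sigma k α) hψ (preservesUniformizers_sigma k α) hU

/-- **`∃!` form** of [AbsAnab] Prop 1.2.1 (vi) at `(k, k, α)`: exactly one `α`-equivariant uniformiser-preserving multiplicative
automorphism of `k̄ˣ`. [cite: MochizukiAbsAnab2004, Prop 1.2.1 (vi) p.10] -/
theorem existsUnique_sigma (α : Field.absoluteGaloisGroup k ≃ₜ* Field.absoluteGaloisGroup k) :
    ∃! ψ : (AlgebraicClosure k)ˣ ≃* (AlgebraicClosure k)ˣ, Prop121vii.IsAlphaEquivariant α ψ ∧ Prop121vii.PreservesUniformizers ψ :=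
  ⟨sigma k α, ⟨isAlphaEquivariant_sigma k α, preservesUniformizers_sigma k α⟩, fun ψ h => sigma_unique k α ψ h.1 h.2⟩

/-- **`σ_{id} = id`** (the identity is `id`-equivariant and uniformiser-preserving; uniqueness).
[cite: MochizukiAbsAnab2004, Prop 1.2.1 (vii) p.11] -/
theorem sigma_refl : sigma k (ContinuousMulEquiv.refl (Field.absoluteGaloisGroup k)) = MulEquiv.refl _ := by
  symm
  refine sigma_unique k _ _ (fun γ x => rfl) ?_
  intro π₁ hπ₁
  exact ⟨π₁, hπ₁, rfl⟩

/-- **`σ_{α ≫ β} = σ_α ≫ σ_β`** (composition of equivariant uniformiser-preserving maps is such; uniqueness) — so the assignment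
`n ↦ σ_n` of §3 is MULTIPLICATIVE. [cite: MochizukiAbsAnab2004, Prop 1.2.1 (vii) p.11] -/
theorem sigma_trans (α β : Field.absoluteGaloisGroup k ≃ₜ* Field.absoluteGaloisGroup k) :
    sigma k (α.trans β) = (sigma k α).trans (sigma k β) := by
  symm
  refine sigma_unique k _ _ (fun γ x => ?_) ?_
  · change sigma k β (sigma k α (γ • x)) = β (α γ) • sigma k β (sigma k α x)
    rw [sigma_smul, sigma_smul]
  · intro π₁ hπ₁
    obtain ⟨π₂, hπ₂, h₂⟩ := preservesUniformizers_sigma k α π₁ hπ₁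
    obtain ⟨π₃, hπ₃, h₃⟩ := preservesUniformizers_sigma k β π₂ hπ₂
    exact ⟨π₃, hπ₃, by rw [MulEquiv.trans_apply, h₂, h₃]⟩

/-- `σ_{α⁻¹} = σ_α⁻¹`. [cite: MochizukiAbsAnab2004, Prop 1.2.1 (vii) p.11] -/
theorem sigma_symm (α : Field.absoluteGaloisGroup k ≃ₜ* Field.absoluteGaloisGroup k) :
    sigma k α.symm = (sigma k α).symm := by
  have h : (sigma k α).trans (sigma k α.symm) = MulEquiv.refl _ := by
    rw [← sigma_trans, ← sigma_refl k]
    congr 1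
    ext γ
    exact α.symm_apply_apply γ
  ext x
  have hx := MulEquiv.congr_fun h ((sigma k α).symm x)
  rw [MulEquiv.trans_apply, MulEquiv.apply_symm_apply, MulEquiv.refl_apply] at hx
  rw [hx]

/-- **FIXED-POINT TRANSPORT**: `σ_α` carries the `U`-fixed units onto the `α(U)`-fixed units — for every subgroup
`U ≤ Gal(k̄/k)`, `σ_α x` is fixed by `α(U)` iff `x` is fixed by `U` (so `σ_α` maps the multiplicative group of `k̄^U` onto that of
`k̄^{α(U)}`: the monoid components of a datum transport over `pull`). [cite: MochizukiAbsAnab2004, Prop 1.2.1 (vi) p.10] -/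
theorem forall_smul_sigma_eq_iff (α : Field.absoluteGaloisGroup k ≃ₜ* Field.absoluteGaloisGroup k)
    (U : Subgroup (Field.absoluteGaloisGroup k)) (x : (AlgebraicClosure k)ˣ) :
    (∀ u ∈ U.map α.toMulEquiv.toMonoidHom, u • sigma k α x = sigma k α x) ↔ ∀ u ∈ U, u • x = x := by
  constructor
  · intro h u hu
    have h' := h (α u) ⟨u, hu, rfl⟩
    rw [← sigma_smul] at h'
    exact (sigma k α).injective h'
  · rintro h _ ⟨u, hu, rfl⟩
    change α u • sigma k α x = sigma k α x
    rw [← sigma_smul, h u hu]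

end MLFSigma

/-! ### §3. At t2's place data `(D, p, k, ι, hX)`: `σ_n` for EVERY transporter `n` of `Π_v̲ = Π_{X̲→_K} ×_{G_F} Gal(k̄/k)` -/

namespace GoodPlaceSigma

/-- The valuative relation of the norm of a normed field `k` (abc-iut-w4-d014's currency bridge `EquivariantUnitRigidityNormed`): the
structure under which the place's `k = K_v̲` is an `IsNonarchimedeanLocalField`.  Used through `letI` only — never an instance.  It is
VERBATIM abc-iut-L5-t16's `GaloisValDatum.normVal k` (`GaloisValDatumOfComplete`); consumers should spell `letI := GaloisValDatum.normVal k`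
(`normValRel_eq_normVal` below, `rfl`; doc v2 self-flag).
[cite: SerreLocalFields1979, Ch. II §1] -/
abbrev normValRel (k : Type) [NontriviallyNormedField k] [IsUltrametricDist k] : ValuativeRel k :=
  ValuativeRel.ofValuation (NormedField.valuation (K := k))

/-- `normValRel` IS abc-iut-L5-t16's `GaloisValDatum.normVal` (same term; doc v2 alias for consumers). [cite: SerreLocalFields1979, Ch. II §1] -/
theorem normValRel_eq_normVal (k : Type) [NontriviallyNormedField k] [IsUltrametricDist k] :
    normValRel k = GaloisValDatum.normVal k := rfl

/-- A normed `ℚ_p`-algebra field `k`, ultrametric and finite over `ℚ_p`, is a non-archimedean local field for `normValRel k`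
(abc-iut-w4-d014 `isNonarchimedeanLocalField_of_finiteDimensional_padic`). [cite: SerreLocalFields1979, Ch. II §1] -/
theorem isNonarchimedeanLocalField (p : ℕ) [Fact p.Prime] (k : Type) [NontriviallyNormedField k] [IsUltrametricDist k]
    [NormedAlgebra ℚ_[p] k] [FiniteDimensional ℚ_[p] k] : @IsNonarchimedeanLocalField k _ (normValRel k) _ :=
  Literature.NumberTheory.LocalFields.isNonarchimedeanLocalField_of_finiteDimensional_padic k p

end GoodPlaceSigma

section PlaceData

open InitialThetaData

variable {F K Fbar : Type} [Field F] [NumberField F] [Field K] [NumberField K] [Algebra F K]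
  [Field Fbar] [Algebra F Fbar] [Algebra K Fbar] [IsScalarTower F K Fbar] [Normal K Fbar]
  {E : WeierstrassCurve F} [E.IsElliptic] {l : ℕ} {Pb : BadPlacePredicates K}
  (D : InitialThetaData F K Fbar E l Pb)
  (p : ℕ) [Fact p.Prime] (k : Type) [NontriviallyNormedField k] [IsUltrametricDist k]
  [NormedAlgebra ℚ_[p] k] [FiniteDimensional ℚ_[p] k] [Algebra K k] (ι : Fbar →ₐ[K] AlgebraicClosure k)

namespace InitialThetaData

omit [NontriviallyNormedField k] [IsUltrametricDist k] [NormedAlgebra ℚ_[p] k] [FiniteDimensional ℚ_[p] k] in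
/-- At the place data, `ρ(Γ) = G_v̲ ⊆ G_K ⊆ augGF(Π_{X̲→_K})` (abc-iut-L5-t2 `decompositionSubgroupGF_le`, `galoisSubgroupOf_le_map_PiXarrow`) —
the surjectivity input `hH` of §1 at `H := Π_{X̲→_K}`. ([IUTchI] Def 3.1 (e) p.62) [claim: Mochizuki2012, status: disputed] -/
theorem range_localToGF_le_map_PiXarrow {k' : Type} [Field k'] [Algebra K k'] (ι' : Fbar →ₐ[K] AlgebraicClosure k') :
    (localToGF F k' ι').range ≤ D.PiXarrow.map D.augGF :=
  (decompositionSubgroupGF_le F k' ι').trans D.galoisSubgroupOf_le_map_PiXarrow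

include p

/-- **`σ_n` AT THE PLACE DATA**: for a transporter `n ∈ N_{Π_{C_F}}(Π_{X̲→_K} ∩ augGF⁻¹ G_v̲)`, THE multiplicative automorphism of
`k̄ˣ` equivariant along `galTransporter n` (§2 `MLFSigma.sigma` at `α := galTransporterCEquiv n`, for the local-field structure
`normValRel` of the place; `Gal(k̄/k)` is compact, racer B `compactSpace_gal_algebraicClosure`).
([IUTchI] Cor 5.3 (ii) p.144) [claim: Mochizuki2012, status: disputed] -/
def sigmaTransporter (hinj : Function.Injective (localToGF F k ι)) (hX : IsOpen (D.PiXarrow : Set D.PiC))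
    (n : ↥(Subgroup.normalizer ((D.PiXarrow ⊓ (localToGF F k ι).range.comap D.augGF : Subgroup D.PiC) : Set D.PiC))) :
    (AlgebraicClosure k)ˣ ≃* (AlgebraicClosure k)ˣ :=
  haveI := Literature.IUT.HodgeTheaters.compactSpace_gal_algebraicClosure p k
  letI := GoodPlaceSigma.normValRel k
  haveI := GoodPlaceSigma.isNonarchimedeanLocalField p k
  haveI : CharZero k := charZero_of_injective_algebraMap (algebraMap ℚ_[p] k).injective
  MLFSigma.sigma k
    (D.galTransporterCEquiv D.PiXarrow (localToGF F k ι) hinj (D.range_localToGF_le_map_PiXarrow ι) hX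
      (continuous_localToGF F k ι) n)

/-- `σ_n` is equivariant along `galTransporter n` on all of `Gal(k̄/k)`: `σ_n (γ • x) = galTransporter n γ • σ_n x`.
([IUTchI] Cor 5.3 (ii) p.144) [claim: Mochizuki2012, status: disputed] -/
theorem sigmaTransporter_smul_gal (hinj : Function.Injective (localToGF F k ι)) (hX : IsOpen (D.PiXarrow : Set D.PiC))
    (n : ↥(Subgroup.normalizer ((D.PiXarrow ⊓ (localToGF F k ι).range.comap D.augGF : Subgroup D.PiC) : Set D.PiC)))
    (γ : AlgebraicClosure k ≃ₐ[k] AlgebraicClosure k) (x : (AlgebraicClosure k)ˣ) :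
    D.sigmaTransporter p k ι hinj hX n (γ • x) =
      D.galTransporter D.PiXarrow (localToGF F k ι) hinj (D.range_localToGF_le_map_PiXarrow ι) n γ •
        D.sigmaTransporter p k ι hinj hX n x := by
  letI := GoodPlaceSigma.normValRel k
  haveI := GoodPlaceSigma.isNonarchimedeanLocalField p k
  haveI : CharZero k := charZero_of_injective_algebraMap (algebraMap ℚ_[p] k).injective
  exact MLFSigma.sigma_smul k _ γ x

/-- **THE EQUIVARIANCE THE DATUM TRANSPORT READS**: `σ_n (augLoc z • x) = augLoc (φ_n z) • σ_n x` for every `z ∈ Π_v̲`, `x ∈ k̄ˣ`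
— i.e. `(φ_n, σ_n)` is an automorphism of the pair `(Π_v̲ ↷ k̄ˣ)` of [AbsTopIII] Def 3.1, for EVERY transporter `n` (Γ-inner or not).
([IUTchI] Cor 5.3 (ii) p.144) [claim: Mochizuki2012, status: disputed] -/
theorem sigmaTransporter_smul (hinj : Function.Injective (localToGF F k ι)) (hX : IsOpen (D.PiXarrow : Set D.PiC))
    (n : ↥(Subgroup.normalizer ((D.PiXarrow ⊓ (localToGF F k ι).range.comap D.augGF : Subgroup D.PiC) : Set D.PiC)))
    (z : D.PiLoc D.PiXarrow (localToGF F k ι)) (x : (AlgebraicClosure k)ˣ) :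
    D.sigmaTransporter p k ι hinj hX n (D.augLoc D.PiXarrow (localToGF F k ι) z • x) =
      D.augLoc D.PiXarrow (localToGF F k ι) (D.transporterEquiv D.PiXarrow (localToGF F k ι) hinj n z) •
        D.sigmaTransporter p k ι hinj hX n x := by
  rw [D.augLoc_transporterEquiv D.PiXarrow (localToGF F k ι) hinj (D.range_localToGF_le_map_PiXarrow ι)]
  exact D.sigmaTransporter_smul_gal p k ι hinj hX n _ x

/-- `σ_n` maps `𝒪_{k̄}^×` onto itself (L4 currency: `Prop121vii.PreservesAbsUnits` for the place's local-field structure `normValRel`).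
([IUTchI] Cor 5.3 (ii) p.144) [claim: Mochizuki2012, status: disputed] -/
theorem preservesAbsUnits_sigmaTransporter (hinj : Function.Injective (localToGF F k ι)) (hX : IsOpen (D.PiXarrow : Set D.PiC))
    (n : ↥(Subgroup.normalizer ((D.PiXarrow ⊓ (localToGF F k ι).range.comap D.augGF : Subgroup D.PiC) : Set D.PiC))) :
    @Prop121vii.PreservesAbsUnits k k _ (GoodPlaceSigma.normValRel k) _ (GoodPlaceSigma.normValRel k)
      (D.sigmaTransporter p k ι hinj hX n) :=
  letI := GoodPlaceSigma.normValRel k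
  haveI := GoodPlaceSigma.isNonarchimedeanLocalField p k
  haveI : CharZero k := charZero_of_injective_algebraMap (algebraMap ℚ_[p] k).injective
  MLFSigma.preservesAbsUnits_sigma k _

/-- `σ_n` carries uniformisers of `k = K_v̲` to uniformisers of `k` (L4 currency: `Prop121vii.PreservesUniformizers`).
([IUTchI] Cor 5.3 (ii) p.144) [claim: Mochizuki2012, status: disputed] -/
theorem preservesUniformizers_sigmaTransporter (hinj : Function.Injective (localToGF F k ι))
    (hX : IsOpen (D.PiXarrow : Set D.PiC))
    (n : ↥(Subgroup.normalizer ((D.PiXarrow ⊓ (localToGF F k ι).range.comap D.augGF : Subgroup D.PiC) : Set D.PiC))) :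
    @Prop121vii.PreservesUniformizers k k _ (GoodPlaceSigma.normValRel k) _ (GoodPlaceSigma.isNonarchimedeanLocalField p k) _
      (GoodPlaceSigma.normValRel k) _ (GoodPlaceSigma.isNonarchimedeanLocalField p k) (D.sigmaTransporter p k ι hinj hX n) :=
  letI := GoodPlaceSigma.normValRel k
  haveI := GoodPlaceSigma.isNonarchimedeanLocalField p k
  haveI : CharZero k := charZero_of_injective_algebraMap (algebraMap ℚ_[p] k).injective
  MLFSigma.preservesUniformizers_sigma k _

/-- **UNIQUENESS of `σ_n`**: any multiplicative automorphism of `k̄ˣ` equivariant along `galTransporter n` and carrying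
uniformisers of `k` to uniformisers IS `σ_n`. ([IUTchI] Cor 5.3 (ii) p.144) [claim: Mochizuki2012, status: disputed] -/
theorem sigmaTransporter_unique (hinj : Function.Injective (localToGF F k ι)) (hX : IsOpen (D.PiXarrow : Set D.PiC))
    (n : ↥(Subgroup.normalizer ((D.PiXarrow ⊓ (localToGF F k ι).range.comap D.augGF : Subgroup D.PiC) : Set D.PiC)))
    (ψ : (AlgebraicClosure k)ˣ ≃* (AlgebraicClosure k)ˣ)
    (hψ : ∀ (γ : AlgebraicClosure k ≃ₐ[k] AlgebraicClosure k) (x : (AlgebraicClosure k)ˣ),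
      ψ (γ • x) = D.galTransporter D.PiXarrow (localToGF F k ι) hinj (D.range_localToGF_le_map_PiXarrow ι) n γ • ψ x)
    (hU : @Prop121vii.PreservesUniformizers k k _ (GoodPlaceSigma.normValRel k) _ (GoodPlaceSigma.isNonarchimedeanLocalField p k) _
      (GoodPlaceSigma.normValRel k) _ (GoodPlaceSigma.isNonarchimedeanLocalField p k) ψ) :
    ψ = D.sigmaTransporter p k ι hinj hX n :=
  letI := GoodPlaceSigma.normValRel k
  haveI := GoodPlaceSigma.isNonarchimedeanLocalField p k
  haveI : CharZero k := charZero_of_injective_algebraMap (algebraMap ℚ_[p] k).injective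
  MLFSigma.sigma_unique k _ ψ hψ hU

/-- **`n ↦ σ_n` is MULTIPLICATIVE**: `σ_{n m} = σ_m ≫ σ_n` (§2 `sigma_trans`). ([IUTchI] Cor 5.3 (ii) p.144) [claim: Mochizuki2012, status: disputed] -/
theorem sigmaTransporter_mul (hinj : Function.Injective (localToGF F k ι)) (hX : IsOpen (D.PiXarrow : Set D.PiC))
    (n m : ↥(Subgroup.normalizer ((D.PiXarrow ⊓ (localToGF F k ι).range.comap D.augGF : Subgroup D.PiC) : Set D.PiC))) :
    D.sigmaTransporter p k ι hinj hX (n * m) = (D.sigmaTransporter p k ι hinj hX m).trans (D.sigmaTransporter p k ι hinj hX n) := by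
  letI := GoodPlaceSigma.normValRel k
  haveI := GoodPlaceSigma.isNonarchimedeanLocalField p k
  haveI : CharZero k := charZero_of_injective_algebraMap (algebraMap ℚ_[p] k).injective
  haveI := Literature.IUT.HodgeTheaters.compactSpace_gal_algebraicClosure p k
  unfold sigmaTransporter
  rw [← MLFSigma.sigma_trans]
  congr 1
  ext γ
  change D.galTransporter D.PiXarrow (localToGF F k ι) hinj _ (n * m) γ = _
  rw [D.galTransporter_mul]
  rfl

/-- `σ_1 = id`. ([IUTchI] Cor 5.3 (ii) p.144) [claim: Mochizuki2012, status: disputed] -/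
theorem sigmaTransporter_one (hinj : Function.Injective (localToGF F k ι)) (hX : IsOpen (D.PiXarrow : Set D.PiC)) :
    D.sigmaTransporter p k ι hinj hX 1 = MulEquiv.refl _ := by
  letI := GoodPlaceSigma.normValRel k
  haveI := GoodPlaceSigma.isNonarchimedeanLocalField p k
  haveI : CharZero k := charZero_of_injective_algebraMap (algebraMap ℚ_[p] k).injective
  haveI := Literature.IUT.HodgeTheaters.compactSpace_gal_algebraicClosure p k
  unfold sigmaTransporter
  rw [← MLFSigma.sigma_refl k]
  congr 1
  ext γ
  change D.galTransporter D.PiXarrow (localToGF F k ι) hinj _ 1 γ = γ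
  rw [D.galTransporter_one, MulEquiv.refl_apply]

/-- `σ_{n⁻¹} = σ_n⁻¹`. ([IUTchI] Cor 5.3 (ii) p.144) [claim: Mochizuki2012, status: disputed] -/
theorem sigmaTransporter_inv (hinj : Function.Injective (localToGF F k ι)) (hX : IsOpen (D.PiXarrow : Set D.PiC))
    (n : ↥(Subgroup.normalizer ((D.PiXarrow ⊓ (localToGF F k ι).range.comap D.augGF : Subgroup D.PiC) : Set D.PiC))) :
    D.sigmaTransporter p k ι hinj hX n⁻¹ = (D.sigmaTransporter p k ι hinj hX n).symm := by
  have h : (D.sigmaTransporter p k ι hinj hX n).trans (D.sigmaTransporter p k ι hinj hX n⁻¹) = MulEquiv.refl _ := by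
    rw [← D.sigmaTransporter_mul, inv_mul_cancel, D.sigmaTransporter_one]
  ext x
  have hx := MulEquiv.congr_fun h ((D.sigmaTransporter p k ι hinj hX n).symm x)
  rw [MulEquiv.trans_apply, MulEquiv.apply_symm_apply, MulEquiv.refl_apply] at hx
  rw [hx]

/-- **Fixed-point transport**: `σ_n x` is fixed by `galTransporter n (U)` iff `x` is fixed by `U`. ([IUTchI] Cor 5.3 (ii) p.144) [claim: Mochizuki2012, status: disputed] -/
theorem forall_smul_sigmaTransporter_eq_iff (hinj : Function.Injective (localToGF F k ι)) (hX : IsOpen (D.PiXarrow : Set D.PiC))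
    (n : ↥(Subgroup.normalizer ((D.PiXarrow ⊓ (localToGF F k ι).range.comap D.augGF : Subgroup D.PiC) : Set D.PiC)))
    (U : Subgroup (AlgebraicClosure k ≃ₐ[k] AlgebraicClosure k)) (x : (AlgebraicClosure k)ˣ) :
    (∀ u ∈ U.map (D.galTransporter D.PiXarrow (localToGF F k ι) hinj (D.range_localToGF_le_map_PiXarrow ι) n).toMonoidHom,
        u • D.sigmaTransporter p k ι hinj hX n x = D.sigmaTransporter p k ι hinj hX n x) ↔
      ∀ u ∈ U, u • x = x := by
  letI := GoodPlaceSigma.normValRel k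
  haveI := GoodPlaceSigma.isNonarchimedeanLocalField p k
  haveI : CharZero k := charZero_of_injective_algebraMap (algebraMap ℚ_[p] k).injective
  haveI := Literature.IUT.HodgeTheaters.compactSpace_gal_algebraicClosure p k
  exact MLFSigma.forall_smul_sigma_eq_iff k
    (D.galTransporterCEquiv D.PiXarrow (localToGF F k ι) hinj (D.range_localToGF_le_map_PiXarrow ι) hX
      (continuous_localToGF F k ι) n) U x

end InitialThetaData

end PlaceData

/-! ### §4. At the merge term: `σ_n` for every transporter of the kit of record's `Π_v̲` at a good nonarchimedean index -/

section AtTerm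

open InitialThetaData

variable {F K Fbar : Type} [Field F] [NumberField F] [Field K] [NumberField K] [Algebra F K]
  [Field Fbar] [Algebra F Fbar] [Algebra K Fbar]
  {E : WeierstrassCurve F} [E.IsElliptic] {l : ℕ} {Pb : BadPlacePredicates K}
  (D : InitialThetaData F K Fbar E l Pb) (CG : D.geom.pe.CuspGalois) (hS : D.CuspClassesNormaliserStable) [Fact l.Prime]
  (M : D.TorsionMonodromy) (hA : D.geom.pe.ArrowCoveringClaims)
  (hI : ∀ k ∈ D.geom.pe.inertia D.geom.pe.ε1, M.tau (D.geom.embK k) = 0)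
  (B : ∀ v, v ∈ D.indexCopyBad → D.BadPairAt v) (ΛBad : ∀ v (h : v ∈ D.indexCopyBad), D.LocalArrowLaw CG hS (B v h).H)
  (I : D.MergeInputs B) (x : D.IndexCopy) (hx : x ∉ D.indexCopyArc) (hxb : x ∉ D.indexCopyBad)

namespace InitialThetaData

include I in
/-- **[IUTchI] Cor 5.3 (ii) at a GOOD nonarchimedean index of the merge term — the anabelian σ for EVERY transporter.**  For every
`n ∈ N_{Π_{C_F}}(Π_v̲)`, `Π_v̲ = (D.localDataOfBadPairs … x).H` (racer B's seam `localDataOfBadPairs_H_at`: `= Π_{X̲→_K} ∩ augGF⁻¹ G_w`,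
`K_w = D.KvAt x hx`), there is a multiplicative automorphism `σ` of `K̄_wˣ` (`K̄_w = AlgebraicClosure (D.KvAt x hx)`) with
`σ (augLoc z • y) = augLoc (φ_n z) • σ y` for all `z ∈ Π_{X̲→_K} ×_{G_F} Gal(K̄_w/K_w)`, `φ_n = transporterEquiv n`, equivariant along
`galTransporter n` on all of `Gal(K̄_w/K_w)` — the [AbsTopIII] Prop 3.2 (iv) input of print's proof, for the NON-Γ-inner
transporters as well (it is `D.sigmaTransporter …`, which moreover preserves `𝒪^×_{K̄_w}` and uniformisers and is unique and
multiplicative in `n`, §3).  Binders: the kit's ∪ {I, x, hx, hxb}; no fact binder. ([IUTchI] Cor 5.3 (ii) p.144) [claim: Mochizuki2012, status: disputed] -/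
theorem exists_sigma_transporterAt [Fact (D.primeAt x hx).Prime]
    (n : ↥(Subgroup.normalizer (((D.localDataOfBadPairs CG hS M hA hI B ΛBad x).H : Subgroup D.PiC) : Set D.PiC))) :
    haveI := D.isScalarTower
    haveI := D.normal_K
    letI := D.algebraKvAt x hx
    ∃ σ : (AlgebraicClosure (D.KvAt x hx))ˣ ≃* (AlgebraicClosure (D.KvAt x hx))ˣ,
      (∀ (z : D.PiLoc D.PiXarrow (localToGF F (D.KvAt x hx) (localEmb (K := K) (Fbar := Fbar) (AlgebraicClosure (D.KvAt x hx)))))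
          (y : (AlgebraicClosure (D.KvAt x hx))ˣ),
          σ (D.augLoc D.PiXarrow _ z • y) =
            D.augLoc D.PiXarrow _ (D.transporterEquiv D.PiXarrow _ (D.localToGF_injective_at x hx)
              ⟨n, by rw [← D.localDataOfBadPairs_H_at CG hS M hA hI B ΛBad x hx hxb]; exact n.2⟩ z) • σ y) ∧
      (∀ (γ : AlgebraicClosure (D.KvAt x hx) ≃ₐ[D.KvAt x hx] AlgebraicClosure (D.KvAt x hx))
          (y : (AlgebraicClosure (D.KvAt x hx))ˣ),
          σ (γ • y) =
            D.galTransporter D.PiXarrow _ (D.localToGF_injective_at x hx) (D.range_localToGF_le_map_PiXarrow _)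
              ⟨n, by rw [← D.localDataOfBadPairs_H_at CG hS M hA hI B ΛBad x hx hxb]; exact n.2⟩ γ • σ y) := by
  haveI := D.isScalarTower
  haveI := D.normal_K
  letI := D.algebraKvAt x hx
  haveI := GaloisValDatum.finiteDimensional_rescaledCompletion K (D.primeAt x hx) (D.specAt x hx) (D.primeAt_mem x hx)
  exact ⟨D.sigmaTransporter (D.primeAt x hx) (D.KvAt x hx) _ (D.localToGF_injective_at x hx)
      (D.isOpen_PiXarrow_of_mergeInputs CG hA B I) _,
    fun z y => D.sigmaTransporter_smul (D.primeAt x hx) (D.KvAt x hx) _ (D.localToGF_injective_at x hx)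
      (D.isOpen_PiXarrow_of_mergeInputs CG hA B I) _ z y,
    fun γ y => D.sigmaTransporter_smul_gal (D.primeAt x hx) (D.KvAt x hx) _ (D.localToGF_injective_at x hx)
      (D.isOpen_PiXarrow_of_mergeInputs CG hA B I) _ γ y⟩

end InitialThetaData

end AtTerm

end Literature.IUT.HodgeTheaters

end
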